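import Summits.AtomisticToContinuum.Crystallization.Theorems.PricedLinkCensusTruncatedCensusGapAffineStackingLaw

/-!
# Finite layer sums of a range-2 potential on the near window (stub N1a)

Stub `stub_barlowLayerSumsWindow` (N1a) of the line `near-far-split` (reshape r1) for the crux
`PricedLinkCensus.TruncatedCensusGap` (item stmt-AtomisticToContinuum-14230).  The statement at
the end is the registered signature VERBATIM.

For a pair potential `V` vanishing on `[2, ∞)` (such as the range-2 truncated Lennard-Jones
potential `V_χ = min 1 (max 0 (4 - 2r)) · V_LJ`, `truncLJ_eq_zero`), an in-layer spacing
`a ≥ 0.93` and a layer spacing `h ≥ 0.72`, the four lattice sums of `BarlowStackingEnergy.lean`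
entering the affine stacking law are EXPLICIT FINITE CLASS SUMS:

* `‖layerVec a h δ k i j‖² = a² q_δ(i,j) + k² h²` with `q_δ(i,j) = i² + ij + j² + δ(i+j) + δ²/3`
  (`norm_layerVec_eq_sqrt_q`);
* outside the window `S = Icc (-2) 2 ×ˢ Icc (-2) 2` one has `q₀ ≥ 5` and `q₁ ≥ 16/3`, hence
  `‖layerVec‖ ≥ 2` and the term vanishes, so each `tsum` over `ℤ²` is a finite sum over the 25
  points of `S` (`tsum_eq_sum`);
* the 25 terms are grouped by the integer `i² + ij + j²` (resp. `i² + ij + j² + i + j`):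
  in-layer shells `q₀ = 1, 3, 4` (six points each) at `a, √3 a, 2a`; adjacent layer
  `q₁ - 1/3 = 0, 1, 2` (3, 3, 6 points) at `√(a²/3+h²), √(4a²/3+h²), √(7a²/3+h²)`; second layer
  non-aligned `q₁ - 1/3 = 0, 1` at `√(a²/3+4h²), √(4a²/3+4h²)` (the class `2` is already out of
  range since `7a²/3 + 4h² ≥ 4` — this is where `h ≥ 0.72` is used), aligned `q₀ = 0, 1` at
  `2h, √(a²+4h²)`; everything else is at distance `≥ 2`;
* `e₀ = ½ Φ₀ + ∑_{k ≥ 1} Φ_N(k) = ½ Φ₀ + Φ_N(1) + Φ_N(2)` since layers at distance `≥ 3` are out of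
  range (`layerInteraction_eq_zero_of_three_le_abs`, `3h ≥ 2`).

Elementary bookkeeping, [folklore].
-/

noncomputable section

namespace Summit.AtomisticToContinuum.Crystallization.Theorems.PricedLinkCensusTruncatedCensusGap

open Literature.MathematicalPhysics.StatisticalMechanics Finset

/-! ### Squared lengths and the window -/

/-- The norm of `layerVec` through the quadratic form
`q_δ(i,j) = i² + ij + j² + δ(i+j) + δ²/3`: `‖layerVec a h δ k i j‖ = √(a² q_δ(i,j) + k² h²)`.
[folklore] -/
theorem norm_layerVec_eq_sqrt_q (a h : ℝ) (δ k i j : ℤ) :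
    ‖layerVec a h δ k i j‖ =
      √(a ^ 2 * ((i : ℝ) ^ 2 + i * j + j ^ 2 + δ * (i + j) + δ ^ 2 / 3) + (k : ℝ) ^ 2 * h ^ 2) := by
  rw [norm_layerVec]
  congr 1
  have h3 : (√3 : ℝ) ^ 2 = 3 := Real.sq_sqrt (by norm_num)
  linear_combination (a ^ 2 / 4 * ((j : ℝ) + δ / 3) ^ 2) * h3

/-- Aligned layers (`δ = 0`): `‖layerVec a h 0 k i j‖ = √(a² n + k² h²)` where
`n = i² + ij + j²`. [folklore] -/
theorem norm_layerVec_zero_eq (a h : ℝ) (k i j : ℤ) {n : ℤ} (hn : i ^ 2 + i * j + j ^ 2 = n) :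
    ‖layerVec a h 0 k i j‖ = √(a ^ 2 * (n : ℝ) + (k : ℝ) ^ 2 * h ^ 2) := by
  rw [norm_layerVec_eq_sqrt_q, ← hn]
  congr 1
  push_cast
  ring

/-- Non-aligned layers (`δ = 1`): `‖layerVec a h 1 k i j‖ = √(a² (n + 1/3) + k² h²)` where
`n = i² + ij + j² + i + j`. [folklore] -/
theorem norm_layerVec_one_eq (a h : ℝ) (k i j : ℤ) {n : ℤ}
    (hn : i ^ 2 + i * j + j ^ 2 + i + j = n) :
    ‖layerVec a h 1 k i j‖ = √(a ^ 2 * ((n : ℝ) + 1 / 3) + (k : ℝ) ^ 2 * h ^ 2) := by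
  rw [norm_layerVec_eq_sqrt_q, ← hn]
  congr 1
  push_cast
  ring

/-- A square root computed from a square: `x = r²`, `r ≥ 0` give `√x = r`. [folklore] -/
theorem sqrt_eq_of_eq_sq {x r : ℝ} (hr : 0 ≤ r) (h : x = r ^ 2) : √x = r := by
  rw [h]
  exact Real.sqrt_sq hr

/-- Outside the window `Icc (-2) 2 ×ˢ Icc (-2) 2` the aligned class is `i² + ij + j² ≥ 5`.
[folklore] -/
theorem five_le_q0_of_not_mem {i j : ℤ} (hij : (i, j) ∉ Icc (-2 : ℤ) 2 ×ˢ Icc (-2 : ℤ) 2) :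
    5 ≤ i ^ 2 + i * j + j ^ 2 := by
  simp only [mem_product, mem_Icc, not_and_or, not_le] at hij
  rcases hij with (h | h) | (h | h) <;> nlinarith [sq_nonneg (2 * j + i), sq_nonneg (2 * i + j)]

/-- Outside the window `Icc (-2) 2 ×ˢ Icc (-2) 2` the non-aligned class is
`i² + ij + j² + i + j ≥ 5`. [folklore] -/
theorem five_le_q1_of_not_mem {i j : ℤ} (hij : (i, j) ∉ Icc (-2 : ℤ) 2 ×ˢ Icc (-2 : ℤ) 2) :
    5 ≤ i ^ 2 + i * j + j ^ 2 + i + j := by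
  simp only [mem_product, mem_Icc, not_and_or, not_le] at hij
  rcases hij with (h | h) | (h | h) <;>
    nlinarith [sq_nonneg (2 * j + i + 1), sq_nonneg (2 * i + j + 1)]

/-- **Out of range outside the window**: for `a ≥ 0.93`, `δ ∈ {0, 1}` and
`(i, j) ∉ Icc (-2) 2 ×ˢ Icc (-2) 2`, `‖layerVec a h δ k i j‖ ≥ 2` (`a² · 5 ≥ 4.32`,
`a² · 16/3 ≥ 4.61`). [folklore] -/
theorem two_le_norm_layerVec_of_not_mem {a : ℝ} (ha : 93 / 100 ≤ a) (h : ℝ) {δ : ℤ}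
    (hδ : δ = 0 ∨ δ = 1) (k : ℤ) {i j : ℤ} (hij : (i, j) ∉ Icc (-2 : ℤ) 2 ×ˢ Icc (-2 : ℤ) 2) :
    2 ≤ ‖layerVec a h δ k i j‖ := by
  rw [norm_layerVec_eq_sqrt_q]
  apply Real.le_sqrt_of_sq_le
  have ha2 : 8649 / 10000 ≤ a ^ 2 := by nlinarith
  have hk : 0 ≤ (k : ℝ) ^ 2 * h ^ 2 := by positivity
  rcases hδ with rfl | rfl
  · have hq : (5 : ℝ) ≤ (i : ℝ) ^ 2 + i * j + j ^ 2 := by exact_mod_cast five_le_q0_of_not_mem hij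
    push_cast
    nlinarith
  · have hq : (5 : ℝ) ≤ (i : ℝ) ^ 2 + i * j + j ^ 2 + i + j := by
      exact_mod_cast five_le_q1_of_not_mem hij
    push_cast
    nlinarith

/-- **The layer sums are finite sums over the window** for a potential vanishing on `[2, ∞)`,
`a ≥ 0.93`, `δ ∈ {0, 1}`. [folklore] -/
theorem layerInteraction_eq_sum_window {V : ℝ → ℝ} (hV : ∀ r, 2 ≤ r → V r = 0) {a : ℝ}
    (ha : 93 / 100 ≤ a) (h : ℝ) {δ : ℤ} (hδ : δ = 0 ∨ δ = 1) (k : ℤ) :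
    layerInteraction V a h δ k =
      ∑ ij ∈ Icc (-2 : ℤ) 2 ×ˢ Icc (-2 : ℤ) 2, V ‖layerVec a h δ k ij.1 ij.2‖ :=
  tsum_eq_sum fun ij hij => hV _ (two_le_norm_layerVec_of_not_mem ha h hδ k (i := ij.1)
    (j := ij.2) hij)

/-- **The punctured in-layer sum is a finite sum over the window** for a potential vanishing on
`[2, ∞)` and `a ≥ 0.93` (in-layer vectors are `layerVec a 0 0 0 i j`). [folklore] -/
theorem inLayerInteraction_eq_sum_window {V : ℝ → ℝ} (hV : ∀ r, 2 ≤ r → V r = 0) {a : ℝ}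
    (ha : 93 / 100 ≤ a) :
    inLayerInteraction V a = ∑ ij ∈ Icc (-2 : ℤ) 2 ×ˢ Icc (-2 : ℤ) 2,
      if ij = 0 then 0 else V ‖layerVec a 0 0 0 ij.1 ij.2‖ := by
  unfold inLayerInteraction
  simp_rw [← layerVec_zero_zero a 0]
  exact tsum_eq_sum fun ij hij => by
    rw [hV _ (two_le_norm_layerVec_of_not_mem ha 0 (Or.inl rfl) 0 (i := ij.1) (j := ij.2) hij),
      ite_self]

/-- Enumeration of the 25 points of the window. [folklore] -/
theorem sum_prod_Icc_neg_two_two (f : ℤ × ℤ → ℝ) :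
    ∑ ij ∈ Icc (-2 : ℤ) 2 ×ˢ Icc (-2 : ℤ) 2, f ij =
      f (-2, -2) + f (-2, -1) + f (-2, 0) + f (-2, 1) + f (-2, 2) +
      (f (-1, -2) + f (-1, -1) + f (-1, 0) + f (-1, 1) + f (-1, 2)) +
      (f (0, -2) + f (0, -1) + f (0, 0) + f (0, 1) + f (0, 2)) +
      (f (1, -2) + f (1, -1) + f (1, 0) + f (1, 1) + f (1, 2)) +
      (f (2, -2) + f (2, -1) + f (2, 0) + f (2, 1) + f (2, 2)) := by
  have hI : Icc (-2 : ℤ) 2 = {-2, -1, 0, 1, 2} := by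
    ext x
    simp only [mem_Icc, mem_insert, mem_singleton]
    omega
  rw [sum_product, hI]
  simp [sum_insert, add_assoc]

/-! ### The four class sums -/

/-- **In-layer shells**: for `V` vanishing on `[2, ∞)` and `a ≥ 0.93`,
`Φ₀ = 6 V(a) + 6 V(√3 a) + 6 V(2a)` (classes `i² + ij + j² = 1, 3, 4`; the classes `≥ 7` are
out of range). [folklore] -/
theorem inLayerInteraction_window {V : ℝ → ℝ} (hV : ∀ r, 2 ≤ r → V r = 0) {a : ℝ}
    (ha : 93 / 100 ≤ a) :
    inLayerInteraction V a = 6 * V a + 6 * V (√3 * a) + 6 * V (2 * a) := by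
  have ha0 : 0 < a := by linarith
  have ha2 : 8649 / 10000 ≤ a ^ 2 := by nlinarith
  have hne : ∀ i j : ℤ, i ^ 2 + i * j + j ^ 2 ≠ 0 → ((i, j) : ℤ × ℤ) ≠ 0 := by
    rintro i j hq hzero
    rw [Prod.mk_eq_zero] at hzero
    obtain ⟨rfl, rfl⟩ := hzero
    exact hq (by norm_num)
  have c0 : (if ((0, 0) : ℤ × ℤ) = 0 then (0 : ℝ) else V ‖layerVec a 0 0 0 0 0‖) = 0 :=
    if_pos (Prod.mk_eq_zero.2 ⟨rfl, rfl⟩)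
  have c1 : ∀ i j : ℤ, i ^ 2 + i * j + j ^ 2 = 1 →
      (if ((i, j) : ℤ × ℤ) = 0 then (0 : ℝ) else V ‖layerVec a 0 0 0 i j‖) = V a := by
    intro i j hn
    rw [if_neg (hne i j (by omega)), norm_layerVec_zero_eq a 0 0 i j hn]
    congr 1
    apply sqrt_eq_of_eq_sq ha0.le
    push_cast
    ring
  have c3 : ∀ i j : ℤ, i ^ 2 + i * j + j ^ 2 = 3 →
      (if ((i, j) : ℤ × ℤ) = 0 then (0 : ℝ) else V ‖layerVec a 0 0 0 i j‖) = V (√3 * a) := by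
    intro i j hn
    rw [if_neg (hne i j (by omega)), norm_layerVec_zero_eq a 0 0 i j hn]
    congr 1
    apply sqrt_eq_of_eq_sq (by positivity)
    push_cast
    rw [mul_pow, Real.sq_sqrt (by norm_num)]
    ring
  have c4 : ∀ i j : ℤ, i ^ 2 + i * j + j ^ 2 = 4 →
      (if ((i, j) : ℤ × ℤ) = 0 then (0 : ℝ) else V ‖layerVec a 0 0 0 i j‖) = V (2 * a) := by
    intro i j hn
    rw [if_neg (hne i j (by omega)), norm_layerVec_zero_eq a 0 0 i j hn]
    congr 1
    apply sqrt_eq_of_eq_sq (by positivity)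
    push_cast
    ring
  have cfar : ∀ i j : ℤ, 5 ≤ i ^ 2 + i * j + j ^ 2 →
      (if ((i, j) : ℤ × ℤ) = 0 then (0 : ℝ) else V ‖layerVec a 0 0 0 i j‖) = 0 := by
    intro i j hn
    rw [if_neg (hne i j (by omega))]
    apply hV
    rw [norm_layerVec_zero_eq a 0 0 i j rfl]
    apply Real.le_sqrt_of_sq_le
    have hq : (5 : ℝ) ≤ ((i ^ 2 + i * j + j ^ 2 : ℤ) : ℝ) := by exact_mod_cast hn
    push_cast at hq ⊢
    nlinarith
  rw [inLayerInteraction_eq_sum_window hV ha, sum_prod_Icc_neg_two_two]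
  simp (disch := decide) only [c0, c1, c3, c4, cfar]
  ring

/-- **Adjacent layer**: for `V` vanishing on `[2, ∞)`, `a ≥ 0.93`, `h ≥ 0.72`,
`Φ_N(1) = 3 V(√(a²/3+h²)) + 3 V(√(4a²/3+h²)) + 6 V(√(7a²/3+h²))` (classes
`i² + ij + j² + i + j = 0, 1, 2`; the classes `≥ 4` are out of range). [folklore] -/
theorem layerInteraction_one_one_window {V : ℝ → ℝ} (hV : ∀ r, 2 ≤ r → V r = 0) {a h : ℝ}
    (ha : 93 / 100 ≤ a) (hh : 72 / 100 ≤ h) :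
    layerInteraction V a h 1 1 = 3 * V (√(a ^ 2 / 3 + h ^ 2)) +
      3 * V (√(4 * a ^ 2 / 3 + h ^ 2)) + 6 * V (√(7 * a ^ 2 / 3 + h ^ 2)) := by
  have ha2 : 8649 / 10000 ≤ a ^ 2 := by nlinarith
  have hh2 : 5184 / 10000 ≤ h ^ 2 := by nlinarith
  have c0 : ∀ i j : ℤ, i ^ 2 + i * j + j ^ 2 + i + j = 0 →
      V ‖layerVec a h 1 1 i j‖ = V (√(a ^ 2 / 3 + h ^ 2)) := by
    intro i j hn
    rw [norm_layerVec_one_eq a h 1 i j hn]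
    congr 2
    push_cast
    ring
  have c1 : ∀ i j : ℤ, i ^ 2 + i * j + j ^ 2 + i + j = 1 →
      V ‖layerVec a h 1 1 i j‖ = V (√(4 * a ^ 2 / 3 + h ^ 2)) := by
    intro i j hn
    rw [norm_layerVec_one_eq a h 1 i j hn]
    congr 2
    push_cast
    ring
  have c2 : ∀ i j : ℤ, i ^ 2 + i * j + j ^ 2 + i + j = 2 →
      V ‖layerVec a h 1 1 i j‖ = V (√(7 * a ^ 2 / 3 + h ^ 2)) := by
    intro i j hn
    rw [norm_layerVec_one_eq a h 1 i j hn]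
    congr 2
    push_cast
    ring
  have cfar : ∀ i j : ℤ, 4 ≤ i ^ 2 + i * j + j ^ 2 + i + j → V ‖layerVec a h 1 1 i j‖ = 0 := by
    intro i j hn
    apply hV
    rw [norm_layerVec_one_eq a h 1 i j rfl]
    apply Real.le_sqrt_of_sq_le
    have hq : (4 : ℝ) ≤ ((i ^ 2 + i * j + j ^ 2 + i + j : ℤ) : ℝ) := by exact_mod_cast hn
    push_cast at hq ⊢
    nlinarith
  rw [layerInteraction_eq_sum_window hV ha h (Or.inr rfl) 1, sum_prod_Icc_neg_two_two]
  simp (disch := decide) only [c0, c1, c2, cfar]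
  ring

/-- **Second layer, non-aligned**: for `V` vanishing on `[2, ∞)`, `a ≥ 0.93`, `h ≥ 0.72`,
`Φ_N(2) = 3 V(√(a²/3+4h²)) + 3 V(√(4a²/3+4h²))` (classes `i² + ij + j² + i + j = 0, 1`; the
class `2` is out of range because `7a²/3 + 4h² ≥ 4.09`, and so are the classes `≥ 4`).
[folklore] -/
theorem layerInteraction_one_two_window {V : ℝ → ℝ} (hV : ∀ r, 2 ≤ r → V r = 0) {a h : ℝ}
    (ha : 93 / 100 ≤ a) (hh : 72 / 100 ≤ h) :
    layerInteraction V a h 1 2 = 3 * V (√(a ^ 2 / 3 + 4 * h ^ 2)) +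
      3 * V (√(4 * a ^ 2 / 3 + 4 * h ^ 2)) := by
  have ha2 : 8649 / 10000 ≤ a ^ 2 := by nlinarith
  have hh2 : 5184 / 10000 ≤ h ^ 2 := by nlinarith
  have c0 : ∀ i j : ℤ, i ^ 2 + i * j + j ^ 2 + i + j = 0 →
      V ‖layerVec a h 1 2 i j‖ = V (√(a ^ 2 / 3 + 4 * h ^ 2)) := by
    intro i j hn
    rw [norm_layerVec_one_eq a h 2 i j hn]
    congr 2
    push_cast
    ring
  have c1 : ∀ i j : ℤ, i ^ 2 + i * j + j ^ 2 + i + j = 1 →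
      V ‖layerVec a h 1 2 i j‖ = V (√(4 * a ^ 2 / 3 + 4 * h ^ 2)) := by
    intro i j hn
    rw [norm_layerVec_one_eq a h 2 i j hn]
    congr 2
    push_cast
    ring
  have cfar : ∀ i j : ℤ, 2 ≤ i ^ 2 + i * j + j ^ 2 + i + j → V ‖layerVec a h 1 2 i j‖ = 0 := by
    intro i j hn
    apply hV
    rw [norm_layerVec_one_eq a h 2 i j rfl]
    apply Real.le_sqrt_of_sq_le
    have hq : (2 : ℝ) ≤ ((i ^ 2 + i * j + j ^ 2 + i + j : ℤ) : ℝ) := by exact_mod_cast hn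
    push_cast at hq ⊢
    nlinarith
  rw [layerInteraction_eq_sum_window hV ha h (Or.inr rfl) 2, sum_prod_Icc_neg_two_two]
  simp (disch := decide) only [c0, c1, cfar]
  ring

/-- **Second layer, aligned**: for `V` vanishing on `[2, ∞)`, `a ≥ 0.93`, `h ≥ 0.72`,
`Φ_A(2) = V(2h) + 6 V(√(a²+4h²))` (classes `i² + ij + j² = 0, 1`; the classes `≥ 3` are out of
range, `3a² + 4h² ≥ 4.67`). [folklore] -/
theorem layerInteraction_zero_two_window {V : ℝ → ℝ} (hV : ∀ r, 2 ≤ r → V r = 0) {a h : ℝ}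
    (ha : 93 / 100 ≤ a) (hh : 72 / 100 ≤ h) :
    layerInteraction V a h 0 2 = V (2 * h) + 6 * V (√(a ^ 2 + 4 * h ^ 2)) := by
  have ha2 : 8649 / 10000 ≤ a ^ 2 := by nlinarith
  have hh2 : 5184 / 10000 ≤ h ^ 2 := by nlinarith
  have c0 : ∀ i j : ℤ, i ^ 2 + i * j + j ^ 2 = 0 → V ‖layerVec a h 0 2 i j‖ = V (2 * h) := by
    intro i j hn
    rw [norm_layerVec_zero_eq a h 2 i j hn]
    congr 1
    apply sqrt_eq_of_eq_sq (by linarith)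
    push_cast
    ring
  have c1 : ∀ i j : ℤ, i ^ 2 + i * j + j ^ 2 = 1 →
      V ‖layerVec a h 0 2 i j‖ = V (√(a ^ 2 + 4 * h ^ 2)) := by
    intro i j hn
    rw [norm_layerVec_zero_eq a h 2 i j hn]
    congr 2
    push_cast
    ring
  have cfar : ∀ i j : ℤ, 3 ≤ i ^ 2 + i * j + j ^ 2 → V ‖layerVec a h 0 2 i j‖ = 0 := by
    intro i j hn
    apply hV
    rw [norm_layerVec_zero_eq a h 2 i j rfl]
    apply Real.le_sqrt_of_sq_le
    have hq : (3 : ℝ) ≤ ((i ^ 2 + i * j + j ^ 2 : ℤ) : ℝ) := by exact_mod_cast hn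
    push_cast at hq ⊢
    nlinarith
  rw [layerInteraction_eq_sum_window hV ha h (Or.inl rfl) 2, sum_prod_Icc_neg_two_two]
  simp (disch := decide) only [c0, c1, cfar]
  ring

/-- **The base energy has two layer terms**: for `V` vanishing on `[2, ∞)` and `h ≥ 0.72`
(so `3h ≥ 2`), `e₀(a,h) = ½ Φ₀ + Φ_N(1) + Φ_N(2)` — the layers at distance `≥ 3` are out of
range (`layerInteraction_eq_zero_of_three_le_abs`). [folklore] -/
theorem barlowBaseEnergy_window {V : ℝ → ℝ} (hV : ∀ r, 2 ≤ r → V r = 0) (a : ℝ) {h : ℝ}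
    (hh : 72 / 100 ≤ h) :
    barlowBaseEnergy V a h = 1 / 2 * inLayerInteraction V a +
      (layerInteraction V a h 1 1 + layerInteraction V a h 1 2) := by
  unfold barlowBaseEnergy
  congr 1
  rw [tsum_eq_sum (s := range 2) (fun k hk => ?_)]
  · simp [sum_range_succ]
  · rw [mem_range, not_lt] at hk
    have hk3 : 3 ≤ k + 1 := by omega
    exact layerInteraction_eq_zero_of_three_le_abs hV (by linarith) a 1
      (by rw [Nat.abs_cast]; exact_mod_cast hk3)

/-! ### The registered statement -/

/-- **STUB (N1a) `stub_barlowLayerSumsWindow`** of the line `near-far-split` (reshape r1): for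
`a ≥ 0.93` and `h ≥ 0.72` the four lattice sums of the range-2 truncated Lennard-Jones
potential `V_χ = min 1 (max 0 (4 - 2r)) · V_LJ` entering the affine stacking law are the
explicit finite class sums (in-layer shells at `a, √3 a, 2a`; adjacent layer at
`√(a²/3+h²), √(4a²/3+h²), √(7a²/3+h²)`; second layer non-aligned at `√(a²/3+4h²), √(4a²/3+4h²)`,
aligned at `2h, √(a²+4h²)`), and `e₀ = ½ Φ₀ + Φ_N(1) + Φ_N(2)`.  Registered signature verbatim;
the general statements for any potential vanishing on `[2, ∞)` are the `*_window` theorems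
above. [folklore] -/
theorem stub_barlowLayerSumsWindow : ∀ (a h : ℝ), 93 / 100 ≤ a → 72 / 100 ≤ h → Literature.MathematicalPhysics.StatisticalMechanics.inLayerInteraction (fun r => min 1 (max 0 (4 - 2 * r)) * Literature.MathematicalPhysics.StatisticalMechanics.lennardJones r) a = 6 * (min 1 (max 0 (4 - 2 * a)) * Literature.MathematicalPhysics.StatisticalMechanics.lennardJones a) + 6 * (min 1 (max 0 (4 - 2 * (√3 * a))) * Literature.MathematicalPhysics.StatisticalMechanics.lennardJones (√3 * a)) + 6 * (min 1 (max 0 (4 - 2 * (2 * a))) * Literature.MathematicalPhysics.StatisticalMechanics.lennardJones (2 * a)) ∧ Literature.MathematicalPhysics.StatisticalMechanics.layerInteraction (fun r => min 1 (max 0 (4 - 2 * r)) * Literature.MathematicalPhysics.StatisticalMechanics.lennardJones r) a h 1 1 = 3 * (min 1 (max 0 (4 - 2 * (√(a ^ 2 / 3 + h ^ 2)))) * Literature.MathematicalPhysics.StatisticalMechanics.lennardJones (√(a ^ 2 / 3 + h ^ 2))) + 3 * (min 1 (max 0 (4 - 2 * (√(4 * a ^ 2 / 3 + h ^ 2))))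 * Literature.MathematicalPhysics.StatisticalMechanics.lennardJones (√(4 * a ^ 2 / 3 + h ^ 2))) + 6 * (min 1 (max 0 (4 - 2 * (√(7 * a ^ 2 / 3 + h ^ 2)))) * Literature.MathematicalPhysics.StatisticalMechanics.lennardJones (√(7 * a ^ 2 / 3 + h ^ 2))) ∧ Literature.MathematicalPhysics.StatisticalMechanics.layerInteraction (fun r => min 1 (max 0 (4 - 2 * r)) * Literature.MathematicalPhysics.StatisticalMechanics.lennardJones r) a h 1 2 = 3 * (min 1 (max 0 (4 - 2 * (√(a ^ 2 / 3 + 4 * h ^ 2)))) * Literature.MathematicalPhysics.StatisticalMechanics.lennardJones (√(a ^ 2 / 3 + 4 * h ^ 2))) + 3 * (min 1 (max 0 (4 - 2 * (√(4 * a ^ 2 / 3 + 4 * h ^ 2)))) * Literature.MathematicalPhysics.StatisticalMechanics.lennardJones (√(4 * a ^ 2 / 3 + 4 * h ^ 2))) ∧ Literature.MathematicalPhysics.StatisticalMechanics.layerInteraction (fun r => min 1 (max 0 (4 - 2 * r)) * Literature.MathematicalPhysics.StatisticalMechanics.lennardJones r) a h 0 2 = (min 1 (max 0 (4 - 2 *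 (2 * h))) * Literature.MathematicalPhysics.StatisticalMechanics.lennardJones (2 * h)) + 6 * (min 1 (max 0 (4 - 2 * (√(a ^ 2 + 4 * h ^ 2)))) * Literature.MathematicalPhysics.StatisticalMechanics.lennardJones (√(a ^ 2 + 4 * h ^ 2))) ∧ Literature.MathematicalPhysics.StatisticalMechanics.barlowBaseEnergy (fun r => min 1 (max 0 (4 - 2 * r)) * Literature.MathematicalPhysics.StatisticalMechanics.lennardJones r) a h = 1 / 2 * Literature.MathematicalPhysics.StatisticalMechanics.inLayerInteraction (fun r => min 1 (max 0 (4 - 2 * r)) * Literature.MathematicalPhysics.StatisticalMechanics.lennardJones r) a + (Literature.MathematicalPhysics.StatisticalMechanics.layerInteraction (fun r => min 1 (max 0 (4 - 2 * r)) * Literature.MathematicalPhysics.StatisticalMechanics.lennardJones r) a h 1 1 + Literature.MathematicalPhysics.StatisticalMechanics.layerInteraction (fun r => min 1 (max 0 (4 - 2 * r)) * Literature.MathematicalPhysics.StatisticalMechanics.lennardJones r) a h 1 2) := by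
  intro a h ha hh
  have hV : ∀ r, 2 ≤ r → (fun r => min 1 (max 0 (4 - 2 * r)) * lennardJones r) r = 0 :=
    fun r hr => truncLJ_eq_zero hr
  exact ⟨inLayerInteraction_window hV ha, layerInteraction_one_one_window hV ha hh,
    layerInteraction_one_two_window hV ha hh, layerInteraction_zero_two_window hV ha hh,
    barlowBaseEnergy_window hV a hh⟩

end Summit.AtomisticToContinuum.Crystallization.Theorems.PricedLinkCensusTruncatedCensusGap
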